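import Mathlib
import HarnessLib
import Summits.ABC.ABC.Theorems.SoloBlindTwoadicCore
import Summits.ABC.ABC.Theorems.SoloBlindOmega3Prelude

/-!
# `ω = 3`, shapes C (`2^k p^m + 1 = qⁿ`) and D (`p^m + 1 = 2^k qⁿ`): the KNOWN side, typed

`Summits/ABC/ABC/Theorems/SoloBlindShapeCDKnown.lean`; namespace `Summit.ABC.ABC.Theorems`
(solo seat `solo-ABC-blind`, wall coordinate C1⁗(1); uses `SoloBlindOmega3Prelude`; the elementary
structure of these shapes is in `SoloBlindShapeCExponent`, `SoloBlindShapeDExponent`, `SoloBlindShapeCDAtlas`).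

The two shapes with `a = 1` are purely ARCHIMEDEAN: the linear form in `log 2, log p, log q` is
`log (c/b) = log (1 + 1/b) < 2/c`, so Matveev for three logarithms (`matveev_three_nat`, `k₀` = the prime of
the largest term) bounds the exponent of the largest odd prime power by the product of the OTHER two
heights times `1 + log B`, and `le_of_lt_mul_log_succ_gen` (`K = 2³⁸`, `K′ = 10¹³`) removes the exponent:

* `shapeC_exponent_bound`, `shapeC_log_c_le` : `2^k p^m + 1 = qⁿ` (`n ≥ 1`) ⟹ `n ≤ 10¹³ · log p · (1 + log log p)`,
  `log qⁿ ≤ 10¹³ · log p · log q · (1 + log log p)`;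
* `shapeD_exponent_bound`, `shapeD_log_c_le` : `p^m + 1 = 2^k qⁿ` (`m ≥ 1`) ⟹ `m ≤ 10¹³ · log q · (1 + log log q)`,
  `log (2^k qⁿ) ≤ 10¹³ · log p · log q · (1 + log log q) + log 2`.

READING.  Again the PRODUCT of the two odd heights where `abc` asks for their SUM; no `N(𝔭)`.
Trust base: `matveev2000_linearFormsLog_rat`, as a hypothesis; everything else is proved.
-/

noncomputable section

namespace Summit.ABC.ABC.Theorems

open Real Height Literature.NumberTheory.Transcendental
  Literature.NumberTheory.DiophantineGeometry.Dioph

/-- **Shape C (`2^k p^m + 1 = qⁿ`), exponent bound.**  `p, q` odd primes, `n ≥ 1`: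
`Λ = n log q − k log 2 − m log p = log (1 + 1/(2^k p^m))` has `0 < Λ ≤ 1/(2^k p^m) ≤ 2/qⁿ`; Matveev with
three logarithms (`k₀ = q`, `B = n`) gives `n < 2³⁸ · log p · (1 + log (n + 1))`, whence
`n ≤ 10¹³ · log p · (1 + log log p)`. [folklore] -/
theorem shapeC_exponent_bound (hM : matveev2000_linearFormsLog_rat) {k m n p q : ℕ}
    (hp : p.Prime) (hq : q.Prime) (hp2 : p ≠ 2) (hq2 : q ≠ 2) (hn : 0 < n)
    (h : 2 ^ k * p ^ m + 1 = q ^ n) :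
    (n : ℝ) ≤ 10 ^ 13 * Real.log p * (1 + Real.log (Real.log p)) := by
  have hp3 : 3 ≤ p := by have := hp.two_le; omega
  have hq3 : 3 ≤ q := by have := hq.two_le; omega
  have hlog2 : 0 < Real.log 2 := Real.log_pos (by norm_num)
  have hlog2' : Real.log 2 < 0.6931471808 := Real.log_two_lt_d9
  have hn1 : (1 : ℝ) ≤ n := by exact_mod_cast hn
  have hpR : (0 : ℝ) < p := by exact_mod_cast hp.pos
  have hqR : (0 : ℝ) < q := by exact_mod_cast hq.pos
  have hP : 1 < Real.log p := by
    have : Real.log (Real.exp 1) < Real.log p := by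
      apply Real.log_lt_log (Real.exp_pos 1)
      have he : Real.exp 1 < 2.7182818286 := Real.exp_one_lt_d9
      have : (3 : ℝ) ≤ p := by exact_mod_cast hp3
      linarith
    rwa [Real.log_exp] at this
  have hQ : 1 < Real.log q := by
    have : Real.log (Real.exp 1) < Real.log q := by
      apply Real.log_lt_log (Real.exp_pos 1)
      have he : Real.exp 1 < 2.7182818286 := Real.exp_one_lt_d9
      have : (3 : ℝ) ≤ q := by exact_mod_cast hq3
      linarith
    rwa [Real.log_exp] at this
  have hP0 : 0 < Real.log p := by linarith
  have hQ0 : 0 < Real.log q := by linarith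
  have hqn : ((q : ℝ) ^ n) = 2 ^ k * (p : ℝ) ^ m + 1 := by exact_mod_cast h.symm
  -- t = 1/(2^k p^m)
  set T : ℝ := (2 : ℝ) ^ k * (p : ℝ) ^ m with hT
  have hT0 : 0 < T := by positivity
  have hT1 : 1 ≤ T := by
    rw [hT]
    exact one_le_mul_of_one_le_of_one_le (one_le_pow₀ (by norm_num))
      (one_le_pow₀ (by exact_mod_cast hp.one_lt.le))
  have hlogT : Real.log T = k * Real.log 2 + m * Real.log p := by
    rw [hT, Real.log_mul (by positivity) (by positivity), Real.log_pow, Real.log_pow]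
  -- Λ = log (q^n) - log T = log (1 + 1/T)
  have hΛeq : -(k : ℝ) * Real.log 2 + -(m : ℝ) * Real.log p + n * Real.log q = Real.log (1 + T⁻¹) := by
    have e1 : Real.log ((q : ℝ) ^ n) - Real.log T = Real.log ((q : ℝ) ^ n / T) :=
      (Real.log_div (by positivity) hT0.ne').symm
    have e2 : (q : ℝ) ^ n / T = 1 + T⁻¹ := by
      rw [hqn]; field_simp
    rw [Real.log_pow, hlogT, e2] at e1
    linarith
  have hΛpos : 0 < Real.log (1 + T⁻¹) := Real.log_pos (by have := inv_pos.mpr hT0; linarith)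
  have hΛle : Real.log (1 + T⁻¹) ≤ T⁻¹ := by
    have := Real.log_le_sub_one_of_pos (by positivity : 0 < 1 + T⁻¹); linarith
  have hlogΛ : Real.log (Real.log (1 + T⁻¹)) ≤ -(k * Real.log 2 + m * Real.log p) := by
    have := Real.log_le_log hΛpos hΛle
    rw [Real.log_inv, hlogT] at this
    exact this
  -- sizes for B = n: 2^k, p^m ≤ T < q^n
  have hTq : T < (q : ℝ) ^ n := by rw [hqn]; linarith
  have hlogTq : k * Real.log 2 + m * Real.log p < n * Real.log q := by
    have := Real.log_lt_log hT0 hTq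
    rw [hlogT, Real.log_pow] at this
    exact this
  have hk0 : (0 : ℝ) ≤ k * Real.log 2 := by positivity
  have hm0 : (0 : ℝ) ≤ m * Real.log p := by positivity
  have key := matveev_three_nat hM (le_refl 2) hp.two_le hq.two_le
    (b₁ := -(k : ℤ)) (b₂ := -(m : ℤ)) (b₃ := (n : ℤ)) (by exact_mod_cast hn.ne')
    (by push_cast; rw [hΛeq]; exact hΛpos.ne')
    (B := (n : ℝ)) hn1
    (by push_cast; rw [abs_neg, Nat.abs_cast]; linarith)
    (by push_cast; rw [abs_neg, Nat.abs_cast]; linarith)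
    (by push_cast; rw [Nat.abs_cast])
  push_cast at key
  rw [hΛeq, abs_of_pos hΛpos] at key
  -- n log q ≤ log 2 + log T, so n log q - log 2 ≤ k log 2 + m log p < 2^38 log 2 log p log q (1 + log n)
  have hqn2 : (n : ℝ) * Real.log q ≤ Real.log 2 + (k * Real.log 2 + m * Real.log p) := by
    have h1 : (q : ℝ) ^ n ≤ 2 * T := by rw [hqn]; linarith
    have h2 := Real.log_le_log (by positivity) h1
    rw [Real.log_pow, Real.log_mul (by norm_num) hT0.ne', hlogT] at h2
    exact h2
  have hmain : (n : ℝ) * Real.log q <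
      Real.log 2 + 2 ^ 38 * (Real.log 2 * Real.log p * Real.log q) * (1 + Real.log n) := by linarith
  -- divide by log q (> 1 > log 2): n < 1 + 2^38 log 2 log p (1 + log n) ≤ 2^38 log p (1 + log (n+1))
  have hlogn : 0 ≤ Real.log (n : ℝ) := Real.log_nonneg hn1
  have hlogn1 : Real.log (n : ℝ) ≤ Real.log ((n : ℝ) + 1) := Real.log_le_log (by linarith) (by linarith)
  have hmain' : (n : ℝ) < 2 ^ 38 * Real.log p * (1 + Real.log ((n : ℝ) + 1)) := by
    by_contra hcon
    push Not at hcon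
    -- Z := 2^38 log p (1 + log n) ≥ 2^38, so log 2 · Z + 1 ≤ Z ≤ 2^38 log p (1 + log (n+1)) ≤ n
    have hZ0 : 0 ≤ 2 ^ 38 * Real.log p * (1 + Real.log (n : ℝ)) := by positivity
    have hZ : (2 : ℝ) ^ 38 ≤ 2 ^ 38 * Real.log p * (1 + Real.log (n : ℝ)) := by
      have : (1 : ℝ) ≤ Real.log p * (1 + Real.log (n : ℝ)) := by nlinarith
      nlinarith
    have hmono : 2 ^ 38 * Real.log p * (1 + Real.log (n : ℝ)) ≤
        2 ^ 38 * Real.log p * (1 + Real.log ((n : ℝ) + 1)) :=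
      mul_le_mul_of_nonneg_left (by linarith) (by positivity)
    have hprod : Real.log 2 * (2 ^ 38 * Real.log p * (1 + Real.log (n : ℝ))) ≤
        0.6931471808 * (2 ^ 38 * Real.log p * (1 + Real.log (n : ℝ))) :=
      mul_le_mul_of_nonneg_right hlog2'.le hZ0
    have h2 : Real.log 2 * (2 ^ 38 * Real.log p * (1 + Real.log (n : ℝ))) + 1 ≤
        2 ^ 38 * Real.log p * (1 + Real.log ((n : ℝ) + 1)) := by linarith
    have h1 : 2 ^ 38 * Real.log p * (1 + Real.log ((n : ℝ) + 1)) * Real.log q ≤ n * Real.log q :=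
      mul_le_mul_of_nonneg_right hcon hQ0.le
    have h3 := mul_le_mul_of_nonneg_right h2 hQ0.le
    -- h3 : (log 2 · Z + 1) log q ≤ 2^38 log p (1 + log(n+1)) log q ≤ n log q < log 2 + log 2 · Z · log q
    have h4 : Real.log 2 < Real.log q := by linarith
    nlinarith
  exact le_of_lt_mul_log_succ_gen (K := 2 ^ 38) (K' := 10 ^ 13) (c := 30) (by norm_num) (by norm_num)
    log_ten_pow_thirteen_lt.le (by norm_num) hn1 hP.le hmain'

/-- **Shape C, known side.**  `2^k p^m + 1 = qⁿ` (`p, q` odd primes, `n ≥ 1`) ⟹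
`log c = log qⁿ ≤ 10¹³ · log p · log q · (1 + log log p)` — granting Matveev's theorem over `ℚ`
(named fact `matveev2000_linearFormsLog_rat`). [folklore] -/
theorem shapeC_log_c_le (hM : matveev2000_linearFormsLog_rat) {k m n p q : ℕ}
    (hp : p.Prime) (hq : q.Prime) (hp2 : p ≠ 2) (hq2 : q ≠ 2) (hn : 0 < n)
    (h : 2 ^ k * p ^ m + 1 = q ^ n) :
    Real.log ((q : ℝ) ^ n) ≤ 10 ^ 13 * Real.log p * Real.log q * (1 + Real.log (Real.log p)) := by
  have hp3 : 3 ≤ p := by have := hp.two_le; omega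
  have hq3 : 3 ≤ q := by have := hq.two_le; omega
  have hP : 1 < Real.log p := by
    have : Real.log (Real.exp 1) < Real.log p := by
      apply Real.log_lt_log (Real.exp_pos 1)
      have he : Real.exp 1 < 2.7182818286 := Real.exp_one_lt_d9
      have : (3 : ℝ) ≤ p := by exact_mod_cast hp3
      linarith
    rwa [Real.log_exp] at this
  have hQ0 : 0 < Real.log q := Real.log_pos (by exact_mod_cast (by omega : 1 < q))
  have hll : 0 < Real.log (Real.log p) := Real.log_pos hP
  have hnle := shapeC_exponent_bound hM hp hq hp2 hq2 hn h
  rw [Real.log_pow]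
  have := mul_le_mul_of_nonneg_right hnle hQ0.le
  nlinarith

/-- **Shape D (`p^m + 1 = 2^k qⁿ`), exponent bound.**  `p, q` odd primes, `m ≥ 1`:
`Λ = k log 2 + n log q − m log p = log (1 + p^{−m})` has `0 < Λ ≤ p^{−m}`; Matveev with three logarithms
(`k₀ = p`, `B = m + 1`) gives `m < 2³⁸ · log q · (1 + log (m + 1))`, whence
`m ≤ 10¹³ · log q · (1 + log log q)`. [folklore] -/
theorem shapeD_exponent_bound (hM : matveev2000_linearFormsLog_rat) {k m n p q : ℕ}
    (hp : p.Prime) (hq : q.Prime) (hp2 : p ≠ 2) (hq2 : q ≠ 2) (hm : 0 < m)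
    (h : p ^ m + 1 = 2 ^ k * q ^ n) :
    (m : ℝ) ≤ 10 ^ 13 * Real.log q * (1 + Real.log (Real.log q)) := by
  have hp3 : 3 ≤ p := by have := hp.two_le; omega
  have hq3 : 3 ≤ q := by have := hq.two_le; omega
  have hlog2 : 0 < Real.log 2 := Real.log_pos (by norm_num)
  have hlog2' : Real.log 2 < 0.6931471808 := Real.log_two_lt_d9
  have hm1 : (1 : ℝ) ≤ m := by exact_mod_cast hm
  have hpR : (0 : ℝ) < p := by exact_mod_cast hp.pos
  have hqR : (0 : ℝ) < q := by exact_mod_cast hq.pos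
  have hP : 1 < Real.log p := by
    have : Real.log (Real.exp 1) < Real.log p := by
      apply Real.log_lt_log (Real.exp_pos 1)
      have he : Real.exp 1 < 2.7182818286 := Real.exp_one_lt_d9
      have : (3 : ℝ) ≤ p := by exact_mod_cast hp3
      linarith
    rwa [Real.log_exp] at this
  have hQ : 1 < Real.log q := by
    have : Real.log (Real.exp 1) < Real.log q := by
      apply Real.log_lt_log (Real.exp_pos 1)
      have he : Real.exp 1 < 2.7182818286 := Real.exp_one_lt_d9
      have : (3 : ℝ) ≤ q := by exact_mod_cast hq3
      linarith
    rwa [Real.log_exp] at this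
  have hP0 : 0 < Real.log p := by linarith
  have hQ0 : 0 < Real.log q := by linarith
  have hlog2p : Real.log 2 ≤ Real.log p :=
    Real.log_le_log (by norm_num) (by exact_mod_cast hp.two_le)
  have hc : (2 : ℝ) ^ k * (q : ℝ) ^ n = (p : ℝ) ^ m + 1 := by exact_mod_cast h.symm
  set P : ℝ := (p : ℝ) ^ m with hPdef
  have hPpos : 0 < P := by positivity
  have hlogP : Real.log P = m * Real.log p := by rw [hPdef, Real.log_pow]
  -- Λ = log(2^k q^n) - log P = log (1 + P⁻¹)
  have hΛeq : (k : ℝ) * Real.log 2 + n * Real.log q + -(m : ℝ) * Real.log p = Real.log (1 + P⁻¹) := by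
    have e1 : Real.log ((2 : ℝ) ^ k * (q : ℝ) ^ n) - Real.log P =
        Real.log ((2 : ℝ) ^ k * (q : ℝ) ^ n / P) := (Real.log_div (by positivity) hPpos.ne').symm
    have e2 : (2 : ℝ) ^ k * (q : ℝ) ^ n / P = 1 + P⁻¹ := by
      rw [hc]; field_simp
    rw [Real.log_mul (by positivity) (by positivity), Real.log_pow, Real.log_pow, hlogP, e2] at e1
    linarith
  have hΛpos : 0 < Real.log (1 + P⁻¹) := Real.log_pos (by have := inv_pos.mpr hPpos; linarith)
  have hΛle : Real.log (1 + P⁻¹) ≤ P⁻¹ := by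
    have := Real.log_le_sub_one_of_pos (by positivity : 0 < 1 + P⁻¹); linarith
  have hlogΛ : Real.log (Real.log (1 + P⁻¹)) ≤ -(m * Real.log p) := by
    have := Real.log_le_log hΛpos hΛle
    rw [Real.log_inv, hlogP] at this
    exact this
  -- sizes: 2^k q^n = P + 1 ≤ 2P, so k log 2 + n log q ≤ log 2 + m log p ≤ (m+1) log p
  have hsize : (k : ℝ) * Real.log 2 + n * Real.log q ≤ Real.log 2 + m * Real.log p := by
    have hP1 : (1 : ℝ) ≤ P := by
      rw [hPdef]; exact one_le_pow₀ (by exact_mod_cast hp.one_lt.le)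
    have h1 : (2 : ℝ) ^ k * (q : ℝ) ^ n ≤ 2 * P := by rw [hc]; linarith
    have h2 := Real.log_le_log (by positivity) h1
    rw [Real.log_mul (by positivity) (by positivity), Real.log_pow, Real.log_pow,
      Real.log_mul (by norm_num) hPpos.ne', hlogP] at h2
    exact h2
  have hk0 : (0 : ℝ) ≤ k * Real.log 2 := by positivity
  have hn0 : (0 : ℝ) ≤ n * Real.log q := by positivity
  have key := matveev_three_nat hM (le_refl 2) hq.two_le hp.two_le
    (b₁ := (k : ℤ)) (b₂ := (n : ℤ)) (b₃ := -(m : ℤ)) (by simpa using hm.ne')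
    (by push_cast; rw [hΛeq]; exact hΛpos.ne')
    (B := (m : ℝ) + 1) (by linarith)
    (by push_cast; rw [Nat.abs_cast]; nlinarith)
    (by push_cast; rw [Nat.abs_cast]; nlinarith)
    (by push_cast; rw [abs_neg, Nat.abs_cast]; linarith)
  push_cast at key
  rw [hΛeq, abs_of_pos hΛpos] at key
  -- m log p < 2^38 log 2 log q log p (1 + log (m+1)) ≤ 2^38 log q log p (1 + log(m+1))
  have hlm : 0 ≤ Real.log ((m : ℝ) + 1) := Real.log_nonneg (by linarith)
  have hmain : (m : ℝ) * Real.log p < 2 ^ 38 * Real.log q * (1 + Real.log ((m : ℝ) + 1)) * Real.log p := by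
    nlinarith
  have hmain' : (m : ℝ) < 2 ^ 38 * Real.log q * (1 + Real.log ((m : ℝ) + 1)) :=
    lt_of_mul_lt_mul_right hmain hP0.le
  exact le_of_lt_mul_log_succ_gen (K := 2 ^ 38) (K' := 10 ^ 13) (c := 30) (by norm_num) (by norm_num)
    log_ten_pow_thirteen_lt.le (by norm_num) hm1 hQ.le hmain'

/-- **Shape D, known side.**  `p^m + 1 = 2^k qⁿ` (`p, q` odd primes, `m ≥ 1`) ⟹
`log c = log (2^k qⁿ) ≤ 10¹³ · log p · log q · (1 + log log q) + log 2` — granting Matveev's theorem over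
`ℚ` (named fact `matveev2000_linearFormsLog_rat`). [folklore] -/
theorem shapeD_log_c_le (hM : matveev2000_linearFormsLog_rat) {k m n p q : ℕ}
    (hp : p.Prime) (hq : q.Prime) (hp2 : p ≠ 2) (hq2 : q ≠ 2) (hm : 0 < m)
    (h : p ^ m + 1 = 2 ^ k * q ^ n) :
    Real.log ((2 : ℝ) ^ k * (q : ℝ) ^ n) ≤
      10 ^ 13 * Real.log p * Real.log q * (1 + Real.log (Real.log q)) + Real.log 2 := by
  have hp3 : 3 ≤ p := by have := hp.two_le; omega
  have hq3 : 3 ≤ q := by have := hq.two_le; omega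
  have hpR : (0 : ℝ) < p := by exact_mod_cast hp.pos
  have hqR : (0 : ℝ) < q := by exact_mod_cast hq.pos
  have hP0 : 0 < Real.log p := Real.log_pos (by exact_mod_cast (by omega : 1 < p))
  have hQ : 1 < Real.log q := by
    have : Real.log (Real.exp 1) < Real.log q := by
      apply Real.log_lt_log (Real.exp_pos 1)
      have he : Real.exp 1 < 2.7182818286 := Real.exp_one_lt_d9
      have : (3 : ℝ) ≤ q := by exact_mod_cast hq3
      linarith
    rwa [Real.log_exp] at this
  have hll : 0 < Real.log (Real.log q) := Real.log_pos hQ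
  have hmle := shapeD_exponent_bound hM hp hq hp2 hq2 hm h
  have hc : (2 : ℝ) ^ k * (q : ℝ) ^ n = (p : ℝ) ^ m + 1 := by exact_mod_cast h.symm
  have h1 : (2 : ℝ) ^ k * (q : ℝ) ^ n ≤ 2 * (p : ℝ) ^ m := by
    rw [hc]; linarith [one_le_pow₀ (M₀ := ℝ) (a := (p : ℝ)) (n := m) (by exact_mod_cast hp.one_lt.le)]
  have h2 := Real.log_le_log (by positivity) h1
  rw [Real.log_mul (by norm_num : (2 : ℝ) ≠ 0) (by positivity : (p : ℝ) ^ m ≠ 0),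
    Real.log_pow (p : ℝ) m] at h2
  have h3 := mul_le_mul_of_nonneg_right hmle hP0.le
  nlinarith

end Summit.ABC.ABC.Theorems

end
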